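import Summits.QuantumFields.YangMills.Theorems.ParabolicTrajectoryTunedSequenceExistsMirrorBound
import Summits.QuantumFields.YangMills.Theorems.ParabolicTrajectoryTunedSequenceExistsMirrorDefs

/-!
# `TunedSequenceExists` (stmt-QuantumFields-10524), line `fixed-aspect-window`:
# the four-child split glue on LANDED names (lead c4, 2026-08-17)

`FixedAspectSplit.FemtoWindowAll` (U), `FixedAspectSplit.VolumeMonotoneAll` (V) (`…SplitDefs`, p137427),
`FixedAspectSplit.MirrorBoundInAll` (A_in), `FixedAspectSplit.MirrorBoundOutAll` (A_out) (`…MirrorDefs`,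
p141070) imply `Summit.QuantumFields.YangMills.Theses.ParabolicTrajectory.TunedSequenceExists`: the mirror
glue `MirrorBound.canonicalUpperBoundAll_of_mirror` (p140782; odd-torus reflection positivity +
Cauchy–Schwarz) gives (A) `CanonicalUpperBoundAll`, then `FixedAspectSplit.tunedSequenceExists_of_subs`.
This file exists only to provide the `--glue-by` declaration of a route-level split of (S) into the four
children on landed names (the bodies of the four registered stubs of `Lines/fixed_aspect_window.lean`).
-/

noncomputable section

open Literature.MathematicalPhysics.QuantumFieldTheory Literature.MathematicalPhysics.QuantumLattice

namespace Summit.QuantumFields.YangMills.Theorems.TunedSequenceExists.MirrorGlue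

variable {G : Type} [Group G] [TopologicalSpace G] [IsTopologicalGroup G] [CompactSpace G]
  [MeasurableSpace G] [BorelSpace G]

/-- (A) from the two NAMED mirror statements at fixed data:
`MirrorBoundIn r → MirrorBoundOut r → CanonicalUpperBound r` (the bodies of `MirrorBoundIn/Out` are the
hypotheses of `MirrorBound.canonicalUpperBound_of_mirror`, definitionally). [cite: OsterwalderSeiler1978, §2] -/
theorem canonicalUpperBound_of_mirrorBounds (r : LatticeRep G)
    (hin : FixedAspectSplit.MirrorBoundIn r) (hout : FixedAspectSplit.MirrorBoundOut r) :
    FixedAspectSplit.CanonicalUpperBound r :=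
  MirrorBound.canonicalUpperBound_of_mirror r hin hout

/-- **Four-child split glue `tunedSequenceExists_of_mirror_subs`** —
`FemtoWindowAll → VolumeMonotoneAll → MirrorBoundInAll → MirrorBoundOutAll →
Summit.QuantumFields.YangMills.Theses.ParabolicTrajectory.TunedSequenceExists` (sorry-free; mirror glue ⇒
(A), then the three-child split glue). [cite: OsterwalderSeiler1978, §2] -/
theorem tunedSequenceExists_of_mirror_subs (hU : FixedAspectSplit.FemtoWindowAll)
    (hV : FixedAspectSplit.VolumeMonotoneAll) (hIn : FixedAspectSplit.MirrorBoundInAll)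
    (hOut : FixedAspectSplit.MirrorBoundOutAll) :
    Summit.QuantumFields.YangMills.Theses.ParabolicTrajectory.TunedSequenceExists :=
  FixedAspectSplit.tunedSequenceExists_of_subs hU hV
    (MirrorBound.canonicalUpperBoundAll_of_mirror hIn hOut)

end Summit.QuantumFields.YangMills.Theorems.TunedSequenceExists.MirrorGlue

end
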